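import Literature.ModelTheory.ExponentialFields.OrderedFieldModels
import Literature.ModelTheory.ExponentialFields.Languages
import Mathlib.ModelTheory.Satisfiability
import HarnessLib

/-!
# Abstract models of the complete theory of an expansion of the real ordered field

Topic `Literature/ModelTheory/ExponentialFields`.  Wilkie's First Main Theorem (J. Amer. Math.
Soc. 9 (1996); den Besten 2016, Theorem 2.1.1) is a statement about *all* models `k ⊆ K` of
`T_{Pf↾} = Th(ℝ | L_{Pf↾})`: arbitrary structures elementarily equivalent to the expansion of
`ℝ̄` under consideration, which the printed proofs at once treat as real closed ordered fields
(den Besten, §1.1 and Lemma 2.3.4: "`k` is a real closed subfield of `K`").  For the exponential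
language this algebraisation is `RealExpModels.lean`; this file gives the **language-independent**
version used for `T_e`, `T_{exp↾}` and any other expansion: let `L'` be a language with a
morphism `ι : L_or → L'` from the language of ordered rings, let `ℝ` carry an `L'`-structure
expanding its ordered-ring structure (`[ι.IsExpansionOn ℝ]`), and let `M` be any `L'`-structure
satisfying `Th(ℝ | L')`.  Then

* in the ordered-ring reduct `ι.reduct M` (Mathlib's `LHom.reduct`; transfer of sentences by
  Mathlib's `realize_iff_of_model_completeTheory`):
  `RealExpansionModel.model_realOrderedFieldTheory` / `model_RCF` — `M ⊨ Th(ℝ̄)`, `M ⊨ RCF`;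
* hence, through `OrderedFieldModel.Dom` (`OrderedFieldModels.lean`), the carrier of `M` is a
  real closed ordered field: `RealExpansionModel.isRealClosed_dom`.

Nothing here is a named fact.

## References

* M. den Besten, MSc thesis, Utrecht 2016, §1.1 (the theory `T`), Lemma 2.3.4. [DenBesten2016]
* D. Marker, *Model Theory: An Introduction* (2002), §1.2–§1.3 (reducts, elementary
  equivalence). [Marker2002]
-/

noncomputable section

open FirstOrder FirstOrder.Language FirstOrder.Language.Structure

namespace Literature.ModelTheory.ExponentialFields

namespace RealExpansionModel

universe u' v' w

variable {L' : FirstOrder.Language.{u', v'}} [L'.Structure ℝ]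
  {M : Type w} [L'.Structure M] [hM : M ⊨ L'.completeTheory ℝ]
  (ι : Language.orderedRing →ᴸ L') [ι.IsExpansionOn ℝ]

include hM in
/-- **A model of `Th(ℝ | L')` is, in its ordered-ring reduct along `ι : L_or → L'`
(`ι.reduct M`, Marker 2002, §1.2), a model of `Th(ℝ̄)`** (`realOrderedFieldTheory`):
ordered-ring sentences transfer through `ι` and Mathlib's
`realize_iff_of_model_completeTheory`. [cite: DenBesten2016, §1.1] -/
theorem model_realOrderedFieldTheory :
    @Theory.Model _ M (ι.reduct M) realOrderedFieldTheory := by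
  letI := ι.reduct M
  haveI := LHom.isExpansionOn_reduct ι M
  refine ⟨fun σ hσ => ?_⟩
  have hR : ℝ ⊨ σ := Language.mem_completeTheory.1 hσ
  have hR' : ℝ ⊨ ι.onSentence σ := (LHom.realize_onSentence ℝ ι σ).2 hR
  have hM' : M ⊨ ι.onSentence σ := (realize_iff_of_model_completeTheory ℝ M _).2 hR'
  exact (LHom.realize_onSentence M ι σ).1 hM'

include hM in
/-- **A model of `Th(ℝ | L')` is, in its ordered-ring reduct, a model of `RCF`** (den Besten
2016, §1.1: models of `T ⊇ T_RCF`; Lemma 2.3.4: "`k` is a real closed subfield of `K`").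
[cite: DenBesten2016, Lemma 2.3.4] -/
theorem model_RCF : @Theory.Model _ M (ι.reduct M) Theory.RCF := by
  letI := ι.reduct M
  haveI := model_realOrderedFieldTheory (M := M) ι
  exact Theory.Model.mono ‹M ⊨ realOrderedFieldTheory› RCF_subset_realOrderedFieldTheory

include hM in
/-- **The carrier of a model of `Th(ℝ | L')` is a real closed ordered field**, the operations
being read off the ordered-ring reduct `ι.reduct M` through `OrderedFieldModel.Dom`
(`OrderedFieldModels.lean`). [cite: DenBesten2016, Lemma 2.3.4] -/
theorem isRealClosed_dom :
    letI := ι.reduct M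
    haveI : M ⊨ Theory.RCF := model_RCF (M := M) ι
    IsRealClosed (OrderedFieldModel.Dom M) := by
  letI := ι.reduct M
  haveI : M ⊨ Theory.RCF := model_RCF (M := M) ι
  exact OrderedFieldModel.isRealClosed

end RealExpansionModel

end Literature.ModelTheory.ExponentialFields
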